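import Literature.Barriers.AtomisticToContinuum.NoBVEstimatesMultiDCauchy
import Mathlib.Analysis.Calculus.LineDeriv.IntegrationByParts
import HarnessLib

/-!
# From `L²`-smallness to sup-smallness of word derivatives (interpolation), and operator-norm
# bounds of the first two Fréchet derivatives through coordinate word derivatives

Brick B-ε, §2 (generic analysis layer), of the Kato existence programme for the symmetrizable
branch of Rauch's Local Existence Theorem (towards `Rauch1986_smallAmplitudeExpansionL2`). The
regularised flows are Cauchy in `L²` (`NoBVEstimatesMultiDCauchy.lean`) and bounded in every
word energy uniformly in `δ` (`NoBVEstimatesMultiDUniformBound.lean`); to pass to a classical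
limit one upgrades `L²`-smallness of a difference `g` with bounded higher word derivatives to
sup-smallness of `g` and of its first two derivatives [Majda1984, Ch. 2, proof of Thm 2.1,
Step 3 ("interpolation")], [TaylorPDEIII2011, Ch. 16, §1, (1.20)–(1.22)]:

* `l2norm_sq_eq_integral_inner`, `l2norm_cwd_sq_le_mul` — **`L²` interpolation**
  `‖∂ᵢg‖₂² ≤ ‖g‖₂ ‖∂ᵢ∂ᵢg‖₂` (one whole-space integration by parts, Mathlib's
  `integral_bilinear_fderiv_right_eq_neg_left_of_integrable`);
* `exists_l2norm_cwd_le` — iterating it: for every order `N`, `ε > 0` and bound `B` there is `η`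
  such that `‖g‖₂ ≤ η` and `‖∂_c g‖₂ ≤ B` (`|c| ≤ N + 1`) force `‖∂_c g‖₂ ≤ ε` (`|c| ≤ N`);
* `exists_norm_cwd_le` — **sup-smallness** of `∂_c g`, `|c| ≤ n`, from `L²`-smallness of `g` and
  `L²` bounds up to order `n + 2(dim+1) + 1` (the tree's Sobolev sup bound
  `norm_sq_le_supConst_mul_wordEnergy`);
* `norm_fderiv_le_sum_cwd`, `norm_fderiv_fderiv_le_sum_cwd` — `‖Dg(x)‖ ≤ Σᵢ ‖∂ᵢg(x)‖`,
  `‖D²g(x)‖ ≤ Σᵢⱼ ‖∂ᵢ∂ⱼg(x)‖`;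
* `norm_moll_moll_sub_self_le` — the sup rate `‖ρ_δ⋆ρ_δ⋆g(x) - g(x)‖ ≤ 2δ Σᵢ sup‖∂ᵢg‖`.

Everything is proved; no named fact and no `sorry` is introduced.

## References

* [Majda1984] A. Majda, *Compressible Fluid Flow and Systems of Conservation Laws in Several
  Space Variables* (1984), Ch. 2, §2.1, Thm 2.1 (proof, Step 3).
* [TaylorPDEIII2011] M. E. Taylor, *Partial Differential Equations III*, 2nd ed. (2011), Ch. 16,
  §1, (1.20)–(1.22); Ch. 13, §3 (interpolation).
-/

noncomputable section

open MeasureTheory Set Function Filter Metric ContinuousLinearMap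
open scoped ContDiff Topology ENNReal NNReal Convolution RealInnerProductSpace

namespace Literature.Barriers.AtomisticToContinuum

open Literature.Analysis.PDE Literature.Analysis.FunctionSpaces

variable {ι : Type*} [Fintype ι] [DecidableEq ι]
variable {V : Type*} [NormedAddCommGroup V] [InnerProductSpace ℝ V]

/-! ### `L²` interpolation by one integration by parts -/

omit [DecidableEq ι] in
/-- `‖f‖₂² = ∫ ⟪f, f⟫` for `f ∈ L²`. [folklore] -/
theorem l2norm_sq_eq_integral_inner {f : EuclideanSpace ℝ ι → V}
    (hf : MemLp f 2 (volume : Measure (EuclideanSpace ℝ ι))) :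
    l2norm f ^ 2 = ∫ x, ⟪f x, f x⟫ := by
  have h1 : l2norm f = ‖hf.toLp f‖ := by rw [Lp.norm_toLp, l2norm_def]
  rw [h1, ← real_inner_self_eq_norm_sq, L2.inner_def]
  refine integral_congr_ae ?_
  filter_upwards [hf.coeFn_toLp] with x hx
  rw [hx]

omit [DecidableEq ι] in
/-- **`L²` interpolation**: `‖∂ᵢg‖₂² ≤ ‖g‖₂ ‖∂ᵢ∂ᵢg‖₂` for a smooth `g` with `g, ∂ᵢg, ∂ᵢ∂ᵢg ∈ L²`
(`∫⟪∂ᵢg, ∂ᵢg⟫ = -∫⟪g, ∂ᵢ∂ᵢg⟫`, Cauchy–Schwarz). [cite: TaylorPDEIII2011, Ch. 13 §3] -/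
theorem l2norm_cwd_sq_le_mul [CompleteSpace V] {g : EuclideanSpace ℝ ι → V} (hg : ContDiff ℝ ∞ g)
    (hg2 : MemLp g 2 (volume : Measure (EuclideanSpace ℝ ι))) (i : ι)
    (hgi : MemLp (cwd [i] g) 2 (volume : Measure (EuclideanSpace ℝ ι)))
    (hgii : MemLp (cwd [i, i] g) 2 (volume : Measure (EuclideanSpace ℝ ι))) :
    l2norm (cwd [i] g) ^ 2 ≤ l2norm g * l2norm (cwd [i, i] g) := by
  have hdi : ∀ x, fderiv ℝ (cwd [i] g) x (bv i) = cwd [i, i] g x := fun x => rfl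
  have hci : (fun x => fderiv ℝ g x (bv i)) = cwd [i] g := rfl
  have hd1 : ∀ x, DifferentiableAt ℝ g x := fun x => (hg.differentiable (by simp)) x
  have hd2 : ∀ x, DifferentiableAt ℝ (cwd [i] g) x := fun x => (differentiable_cwd hg [i]) x
  -- integration by parts
  have key := integral_bilinear_fderiv_right_eq_neg_left_of_integrable
    (μ := (volume : Measure (EuclideanSpace ℝ ι))) (B := ipCLM V) (f := g) (g := cwd [i] g)
    (v := bv i)
    (by
      simp only [ipCLM_apply]
      exact (integrable_inner_of_memLp hgi hgi : Integrable (fun x => ⟪cwd [i] g x, cwd [i] g x⟫) volume))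
    (by simpa only [ipCLM_apply, hdi] using integrable_inner_of_memLp hg2 hgii)
    (by simpa only [ipCLM_apply] using integrable_inner_of_memLp hg2 hgi)
    (fun x _ => hd1 x) (fun x _ => hd2 x)
  simp only [ipCLM_apply, hdi] at key
  rw [l2norm_sq_eq_integral_inner hgi]
  have h2 : ∫ x, ⟪cwd [i] g x, cwd [i] g x⟫ = -∫ x, ⟪g x, cwd [i, i] g x⟫ := by
    have : (fun x => ⟪cwd [i] g x, cwd [i] g x⟫) = fun x => ⟪fderiv ℝ g x (bv i), cwd [i] g x⟫ := rfl
    rw [this]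
    linarith [key]
  rw [h2]
  calc -∫ x, ⟪g x, cwd [i, i] g x⟫ ≤ |∫ x, ⟪g x, cwd [i, i] g x⟫| := neg_le_abs _
    _ ≤ l2norm g * l2norm (cwd [i, i] g) := abs_integral_inner_le_l2norm hg2 hgii

omit [DecidableEq ι] in
/-- **Iterated `L²` interpolation**: for every order `N`, every `ε > 0` and every `B ≥ 0` there
is `η > 0` such that a smooth field with all word derivatives in `L²`, `‖∂_c g‖₂ ≤ B` for
`|c| ≤ N + 1` and `‖g‖₂ ≤ η` has `‖∂_c g‖₂ ≤ ε` for all `|c| ≤ N`.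
[cite: TaylorPDEIII2011, Ch. 13 §3] -/
theorem exists_l2norm_cwd_le [CompleteSpace V] (N : ℕ) :
    ∀ ε : ℝ, 0 < ε → ∀ B : ℝ, 0 ≤ B → ∃ η : ℝ, 0 < η ∧
      ∀ g : EuclideanSpace ℝ ι → V, ContDiff ℝ ∞ g →
        (∀ c : List ι, MemLp (cwd c g) 2 (volume : Measure (EuclideanSpace ℝ ι))) →
        (∀ c : List ι, c.length ≤ N + 1 → l2norm (cwd c g) ≤ B) →
        l2norm g ≤ η → ∀ c : List ι, c.length ≤ N → l2norm (cwd c g) ≤ ε := by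
  induction N with
  | zero =>
    intro ε hε B hB
    refine ⟨ε, hε, fun g _ _ _ hη c hc => ?_⟩
    have : c = [] := List.eq_nil_of_length_eq_zero (Nat.le_zero.1 hc)
    subst this
    simpa using hη
  | succ N ih =>
    intro ε hε B hB
    set ε' : ℝ := min ε (ε ^ 2 / (B + 1)) with hε'
    have hε'0 : 0 < ε' := lt_min hε (by positivity)
    obtain ⟨η, hη0, hη⟩ := ih ε' hε'0 B hB
    refine ⟨η, hη0, fun g hg hmem hbd hsmall c hc => ?_⟩
    have hbd' : ∀ c : List ι, c.length ≤ N + 1 → l2norm (cwd c g) ≤ B :=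
      fun c hc' => hbd c (by omega)
    rcases Nat.lt_or_ge c.length (N + 1) with hlt | hge
    · exact (hη g hg hmem hbd' hsmall c (by omega)).trans (min_le_left _ _)
    · -- `|c| = N + 1`, `c = i :: c'`
      obtain ⟨i, c', rfl⟩ : ∃ i c', c = i :: c' := by
        cases c with
        | nil => simp at hge
        | cons i c' => exact ⟨i, c', rfl⟩
      simp only [List.length_cons] at hc hge
      have hc' : c'.length ≤ N := by omega
      have hsm : l2norm (cwd c' g) ≤ ε' := hη g hg hmem hbd' hsmall c' hc'
      -- interpolation on `cwd c' g`
      have h1 := l2norm_cwd_sq_le_mul (contDiff_cwd hg c') (hmem c') i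
        (by simpa [← cwd_append] using hmem ([i] ++ c'))
        (by simpa [← cwd_append] using hmem ([i, i] ++ c'))
      have h2 : cwd [i] (cwd c' g) = cwd (i :: c') g := by rw [← cwd_append]; rfl
      have h3 : cwd [i, i] (cwd c' g) = cwd (i :: i :: c') g := by rw [← cwd_append]; rfl
      rw [h2, h3] at h1
      have h4 : l2norm (cwd (i :: i :: c') g) ≤ B := hbd _ (by simp; omega)
      have h5 : l2norm (cwd (i :: c') g) ^ 2 ≤ ε' * B :=
        h1.trans (mul_le_mul hsm h4 (l2norm_nonneg _) hε'0.le)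
      have h6 : ε' * B ≤ ε ^ 2 := by
        calc ε' * B ≤ ε ^ 2 / (B + 1) * B := mul_le_mul_of_nonneg_right (min_le_right _ _) hB
          _ ≤ ε ^ 2 / (B + 1) * (B + 1) := by gcongr; linarith
          _ = ε ^ 2 := by field_simp
      exact (pow_le_pow_iff_left₀ (l2norm_nonneg _) hε.le two_ne_zero).1 (h5.trans h6)

/-- **Sup-smallness from `L²`-smallness.** For every order `n`, `ε > 0` and `B ≥ 0` there is
`η > 0` such that a smooth field with all word derivatives bounded and in `L²`,
`‖∂_c g‖₂ ≤ B` for `|c| ≤ n + 2(dim+1) + 1`, and `‖g‖₂ ≤ η`, satisfies `‖∂_c g(x)‖ ≤ ε` for all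
`x` and `|c| ≤ n` (iterated interpolation and the Sobolev sup bound).
[cite: Majda1984, Ch. 2 §2.1, Thm 2.1 (proof, Step 3)] -/
theorem exists_norm_cwd_le [CompleteSpace V] [FiniteDimensional ℝ V] (n : ℕ) :
    ∀ ε : ℝ, 0 < ε → ∀ B : ℝ, 0 ≤ B → ∃ η : ℝ, 0 < η ∧
      ∀ g : EuclideanSpace ℝ ι → V, ContDiff ℝ ∞ g →
        (∀ c : List ι, MemLp (cwd c g) 2 (volume : Measure (EuclideanSpace ℝ ι))) →
        (∀ c : List ι, ∃ C : ℝ, ∀ x, ‖cwd c g x‖ ≤ C) →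
        (∀ c : List ι, c.length ≤ n + 2 * (Fintype.card ι + 1) + 1 → l2norm (cwd c g) ≤ B) →
        l2norm g ≤ η → ∀ c : List ι, c.length ≤ n → ∀ x, ‖cwd c g x‖ ≤ ε := by
  intro ε hε B hB
  set n₀ : ℕ := 2 * (Fintype.card ι + 1) with hn₀
  set Ncard : ℝ := ((wordsLE ι n₀).card : ℝ) with hNcard
  have hNc0 : 0 ≤ Ncard := Nat.cast_nonneg _
  -- `L²`-smallness level `ε₁` at orders `≤ n + n₀`
  set ε₁ : ℝ := ε / (Real.sqrt (supConst ι V * Ncard) + 1) with hε₁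
  have hε₁0 : 0 < ε₁ := by positivity
  obtain ⟨η, hη0, hη⟩ := exists_l2norm_cwd_le (ι := ι) (V := V) (n + n₀) ε₁ hε₁0 B hB
  refine ⟨η, hη0, fun g hg hmem hbdd hB' hsmall c hc x => ?_⟩
  have hsmallc : ∀ u : List ι, u.length ≤ n₀ → l2norm (cwd (u ++ c) g) ≤ ε₁ := fun u hu =>
    hη g hg hmem (fun c' hc' => hB' c' (by omega)) hsmall (u ++ c) (by simp; omega)
  -- Sobolev sup bound for `f = cwd c g`
  set f := cwd c g with hf
  have hfs : ContDiff ℝ ∞ f := contDiff_cwd hg c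
  have hfb : ∀ u : List ι, ∃ C : ℝ, ∀ y, ‖cwd u f y‖ ≤ C := fun u => by
    rw [hf, ← cwd_append]; exact hbdd (u ++ c)
  have hfm : ∀ u : List ι, MemLp (cwd u f) 2 (volume : Measure (EuclideanSpace ℝ ι)) := fun u => by
    rw [hf, ← cwd_append]; exact hmem (u ++ c)
  have h1 := norm_sq_le_supConst_mul_wordEnergy hfs hfb hfm x
  have h2 : wordEnergy n₀ f ≤ Ncard * ε₁ ^ 2 := by
    rw [wordEnergy]
    calc ∑ u ∈ wordsLE ι n₀, l2norm (cwd u f) ^ 2 ≤ ∑ _u ∈ wordsLE ι n₀, ε₁ ^ 2 := by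
          refine Finset.sum_le_sum fun u hu => ?_
          rw [hf, ← cwd_append]
          exact pow_le_pow_left₀ (l2norm_nonneg _) (hsmallc u (mem_wordsLE.1 hu)) 2
      _ = Ncard * ε₁ ^ 2 := by rw [Finset.sum_const, nsmul_eq_mul, hNcard]
  have h3 : ‖f x‖ ^ 2 ≤ (Real.sqrt (supConst ι V * Ncard) * ε₁) ^ 2 := by
    rw [mul_pow, Real.sq_sqrt (mul_nonneg supConst_nonneg hNc0)]
    calc ‖f x‖ ^ 2 ≤ supConst ι V * wordEnergy n₀ f := h1
      _ ≤ supConst ι V * (Ncard * ε₁ ^ 2) := mul_le_mul_of_nonneg_left h2 supConst_nonneg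
      _ = supConst ι V * Ncard * ε₁ ^ 2 := by ring
  have h4 : ‖f x‖ ≤ Real.sqrt (supConst ι V * Ncard) * ε₁ :=
    (pow_le_pow_iff_left₀ (norm_nonneg _) (by positivity) two_ne_zero).1 h3
  refine h4.trans ?_
  rw [hε₁]
  rw [mul_div_assoc']
  rw [div_le_iff₀ (by positivity)]
  nlinarith [Real.sqrt_nonneg (supConst ι V * Ncard)]

/-! ### Operator norms of `Dg`, `D²g` through word derivatives -/

section OpNorm

variable {F : Type*} [NormedAddCommGroup F] [NormedSpace ℝ F]

omit [DecidableEq ι] in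
/-- `‖Dg(x)‖ ≤ Σᵢ ‖∂ᵢg(x)‖`. [folklore] -/
theorem norm_fderiv_le_sum_cwd (g : EuclideanSpace ℝ ι → F) (x : EuclideanSpace ℝ ι) :
    ‖fderiv ℝ g x‖ ≤ ∑ i, ‖cwd [i] g x‖ :=
  opNorm_le_sum_norm_apply_bv _

omit [DecidableEq ι] in
/-- `(D²g(x) eᵢ) eⱼ = ∂ᵢ∂ⱼg(x)` for smooth `g` (evaluation commutes with differentiation).
[folklore] -/
theorem fderiv_fderiv_apply_bv (g : EuclideanSpace ℝ ι → F) (hg : ContDiff ℝ ∞ g)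
    (x : EuclideanSpace ℝ ι) (i j : ι) :
    fderiv ℝ (fderiv ℝ g) x (bv i) (bv j) = cwd [i, j] g x := by
  have hc : DifferentiableAt ℝ (fderiv ℝ g) x :=
    ((hg.fderiv_right (m := ∞) (by norm_cast)).differentiable (by simp)) x
  have h1 : fderiv ℝ (fun y => fderiv ℝ g y (bv j)) x = (fderiv ℝ (fderiv ℝ g) x).flip (bv j) := by
    rw [fderiv_clm_apply hc (differentiableAt_const _)]
    simp
  have h2 : cwd [i, j] g x = fderiv ℝ (fun y => fderiv ℝ g y (bv j)) x (bv i) := rfl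
  rw [h2, h1, ContinuousLinearMap.flip_apply]

omit [DecidableEq ι] in
/-- `‖D²g(x)‖ ≤ Σᵢ Σⱼ ‖∂ᵢ∂ⱼg(x)‖` for smooth `g`. [folklore] -/
theorem norm_fderiv_fderiv_le_sum_cwd (g : EuclideanSpace ℝ ι → F) (hg : ContDiff ℝ ∞ g)
    (x : EuclideanSpace ℝ ι) :
    ‖fderiv ℝ (fderiv ℝ g) x‖ ≤ ∑ i, ∑ j, ‖cwd [i, j] g x‖ := by
  refine (opNorm_le_sum_norm_apply_bv _).trans (Finset.sum_le_sum fun i _ => ?_)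
  refine (opNorm_le_sum_norm_apply_bv _).trans (Finset.sum_le_sum fun j _ => ?_)
  rw [fderiv_fderiv_apply_bv g hg x i j]

end OpNorm

/-! ### The sup rate of the double mollification -/

variable {d : ℕ}

/-- **`‖(ρ_δ ⋆ (ρ_δ ⋆ g))(x) - g(x)‖ ≤ 2δ Σᵢ Kᵢ`** when `g` is smooth with
`‖∂ᵢg‖ ≤ Kᵢ` everywhere (the sup rate of mollification, twice). [cite: Evans2010, App. C.4 Thm. 7] -/
theorem norm_moll_moll_sub_self_le {F : Type*} [NormedAddCommGroup F] [NormedSpace ℝ F]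
    [CompleteSpace F] {δ : ℝ} (hδ : 0 < δ)
    {g : EuclideanSpace ℝ (Fin d) → F} (hg : ContDiff ℝ ∞ g) {K : Fin d → ℝ}
    (hK : ∀ i y, ‖cwd [i] g y‖ ≤ K i) (x : EuclideanSpace ℝ (Fin d)) :
    ‖(moll (Fin d) hδ ⋆[lsmul ℝ ℝ, volume] (moll (Fin d) hδ ⋆[lsmul ℝ ℝ, volume] g)) x - g x‖ ≤
      2 * δ * ∑ i, K i := by
  set ρ := moll (Fin d) hδ with hρ
  have hsum0 : 0 ≤ ∑ i, K i := Finset.sum_nonneg fun i _ => (norm_nonneg _).trans (hK i 0)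
  -- `‖Dg‖ ≤ Σ Kᵢ` and the same for `ρ ⋆ g`
  have hDg : ∀ y, ‖fderiv ℝ g y‖ ≤ ∑ i, K i := fun y =>
    (norm_fderiv_le_sum_cwd g y).trans (Finset.sum_le_sum fun i _ => hK i y)
  have hgl : LocallyIntegrable g (volume : Measure (EuclideanSpace ℝ (Fin d))) :=
    hg.continuous.locallyIntegrable
  have hρg : ContDiff ℝ ∞ (ρ ⋆[lsmul ℝ ℝ, volume] g) :=
    contDiff_convolution_kernel (contDiff_moll hδ) (hasCompactSupport_moll hδ) hgl
  have hDρg : ∀ y, ‖fderiv ℝ (ρ ⋆[lsmul ℝ ℝ, volume] g) y‖ ≤ ∑ i, K i := by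
    intro y
    refine (norm_fderiv_le_sum_cwd _ y).trans (Finset.sum_le_sum fun i _ => ?_)
    rw [cwd_convolution_eq_convolution_cwd (continuous_moll hδ) (hasCompactSupport_moll hδ) hg [i]]
    exact norm_normed_convolution_le (bump (Fin d) hδ) (continuous_cwd hg [i]) fun z _ => hK i z
  have h1 : ‖(ρ ⋆[lsmul ℝ ℝ, volume] g) x - g x‖ ≤ δ * ∑ i, K i := by
    have := norm_normed_convolution_sub_self_le (bump (Fin d) hδ) (hg.of_le (by exact_mod_cast le_top))
      (x := x) (fun y _ => hDg y)
    simp only [bump_rOut] at this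
    exact this
  have h2 : ‖(ρ ⋆[lsmul ℝ ℝ, volume] (ρ ⋆[lsmul ℝ ℝ, volume] g)) x - (ρ ⋆[lsmul ℝ ℝ, volume] g) x‖ ≤
      δ * ∑ i, K i := by
    have := norm_normed_convolution_sub_self_le (bump (Fin d) hδ)
      (hρg.of_le (by exact_mod_cast le_top)) (x := x) (fun y _ => hDρg y)
    simp only [bump_rOut] at this
    exact this
  calc ‖(ρ ⋆[lsmul ℝ ℝ, volume] (ρ ⋆[lsmul ℝ ℝ, volume] g)) x - g x‖
      = ‖((ρ ⋆[lsmul ℝ ℝ, volume] (ρ ⋆[lsmul ℝ ℝ, volume] g)) x - (ρ ⋆[lsmul ℝ ℝ, volume] g) x) +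
          ((ρ ⋆[lsmul ℝ ℝ, volume] g) x - g x)‖ := by rw [sub_add_sub_cancel]
    _ ≤ δ * ∑ i, K i + δ * ∑ i, K i := (norm_add_le _ _).trans (add_le_add h2 h1)
    _ = 2 * δ * ∑ i, K i := by ring

end Literature.Barriers.AtomisticToContinuum

end
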